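import Summits.ValiantsHypothesis.ValiantsHypothesis.Theorems.BarrierLeverChowHitsPartitionMinorsRStarvedCoeffs
import Summits.ValiantsHypothesis.ValiantsHypothesis.Theorems.BarrierLeverChowThinRowsSubcubePrelims
import Summits.ValiantsHypothesis.ValiantsHypothesis.Theorems.BarrierLeverChowStarveTinv

/-!
# Route BarrierLever — item `ChowHitsPartitionMinorsR` (stmt-ValiantsHypothesis-21882), STARVED DESIGN V:
# reduced row polynomials of the starved design and their coefficient tables

Helper file (`--supports stmt-ValiantsHypothesis-21882`; cell valiant-natproofs, rung V4, 𝒟-side; prover seat val-np-p5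
gen 31). Closes NO item. Fifth file of the kernel chain for THEOREM A′ of memo MEMO-21882-valnp5-g31.md §3/§5 (K-A3b-2).

For the starved design (`…RStarvedCoeffs`: tables `desA w α β`, `desB w`, counts `inc`): the REDUCED vertex polynomial
`rr v = ρ̂₁ v − (1 + inc v ∅)` (constant-free, `y`-only) with coefficient table
`coeff (E ∅ W) (rr v) = (−1)^{|W|} |W|! ([W = {v}] + inc v W)` for `0 < |W| ≤ 3` (`coeff_rr`), the pair-form defect
`qq j = t_{inr j} − 1` with `coeff (E ∅ W) (qq j) = (−1)^{|W|} |W|! [W ⊆ w j]` (`coeff_qq`), and the PRODUCT TABLES at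
exponents of size `2` and `3` (`coeff_rr_mul_rr_two/three`, `coeff_qq_sq_two/three`; products of constant-free `y`-only
polynomials vanish at exponents of size `≤ 1`: `ChowStarve.coeff_mul_of_noConst_card_le_one`).

WHAT THIS IS NOT: the pivot/vanishing case analysis and the determinant are the sequel (K-A3b-3); nothing on crux
stmt-ValiantsHypothesis-14610 or on `VP` versus `VNP`.
-/

set_option linter.dupNamespace false

namespace Summit.ValiantsHypothesis.ValiantsHypothesis.Theorems.BarrierLever.ChowStarvedDesign

open Finset MvPolynomial
open Summit.ValiantsHypothesis.ValiantsHypothesis.Theorems.BarrierLever.ChowSubcube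
  (yOnly_mul yOnly_add yOnly_sum yOnly_monomial)
open Summit.ValiantsHypothesis.ValiantsHypothesis.Theorems.BarrierLever.ChowStarve
  (coeff_mul_of_noConst_card_le_one coeff_mul_of_noConst_card_two coeff_mul_of_noConst_card_three)

noncomputable section

variable {h r : ℕ}

/-! ## 1. `y`-only polynomials (closure lemmas) -/

/-- Constants are `y`-only. -/
theorem yOnly_C (c : ℂ) : ∀ s ∈ (C c : MvPolynomial (Fin (h + h)) ℂ).support, ∀ a : Fin h, s (Fin.castAdd h a) = 0 := by
  rw [← monomial_zero']
  exact yOnly_monomial 0 c fun a => rfl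

/-- Negation preserves `y`-only. -/
theorem yOnly_neg {p : MvPolynomial (Fin (h + h)) ℂ} (hp : ∀ s ∈ p.support, ∀ a : Fin h, s (Fin.castAdd h a) = 0) :
    ∀ s ∈ (-p).support, ∀ a : Fin h, s (Fin.castAdd h a) = 0 := by
  intro s hs a
  rw [support_neg] at hs
  exact hp s hs a

/-- Subtraction preserves `y`-only. -/
theorem yOnly_sub {p q : MvPolynomial (Fin (h + h)) ℂ} (hp : ∀ s ∈ p.support, ∀ a : Fin h, s (Fin.castAdd h a) = 0)
    (hq : ∀ s ∈ q.support, ∀ a : Fin h, s (Fin.castAdd h a) = 0) :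
    ∀ s ∈ (p - q).support, ∀ a : Fin h, s (Fin.castAdd h a) = 0 := by
  rw [sub_eq_add_neg]
  exact yOnly_add hp (yOnly_neg hq)

/-- Powers preserve `y`-only. -/
theorem yOnly_pow {p : MvPolynomial (Fin (h + h)) ℂ} (hp : ∀ s ∈ p.support, ∀ a : Fin h, s (Fin.castAdd h a) = 0)
    (n : ℕ) : ∀ s ∈ (p ^ n).support, ∀ a : Fin h, s (Fin.castAdd h a) = 0 := by
  induction n with
  | zero => rw [pow_zero, ← C_1]; exact yOnly_C 1
  | succ n ih => rw [pow_succ]; exact yOnly_mul ih hp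

/-- A linear `y`-form is `y`-only. -/
theorem yOnly_linY {ι : Type*} (B : ι → Fin h → ℂ) (k : ι) :
    ∀ s ∈ (linY B k).support, ∀ a : Fin h, s (Fin.castAdd h a) = 0 := by
  unfold linY
  refine yOnly_sum _ _ fun c _ => ?_
  rw [C_mul_X_eq_monomial]
  refine yOnly_monomial _ _ fun a => ?_
  rw [Finsupp.single_apply, if_neg (ProductStateSums.castAdd_ne_natAdd a c).symm]

/-- A truncated inverse is `y`-only. -/
theorem yOnly_tinv {ι : Type*} (B : ι → Fin h → ℂ) (k : ι) :
    ∀ s ∈ (tinv B k).support, ∀ a : Fin h, s (Fin.castAdd h a) = 0 := by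
  unfold tinv
  rw [← C_1]
  exact yOnly_sub (yOnly_add (yOnly_sub (yOnly_C 1) (yOnly_linY B k)) (yOnly_pow (yOnly_linY B k) 2))
    (yOnly_pow (yOnly_linY B k) 3)

/-- `ρ̂₁` is `y`-only. -/
theorem yOnly_rho1 {ι : Type*} [DecidableEq ι] (A B : ι → Fin h → ℂ) (K : Finset ι) (v : Fin h) :
    ∀ s ∈ (rho1 A B K v).support, ∀ a : Fin h, s (Fin.castAdd h a) = 0 := by
  unfold rho1
  exact yOnly_sum _ _ fun k _ => yOnly_mul (yOnly_C _) (yOnly_tinv B k)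

/-- The exponent `E ∅ W` of a nonempty `W` is nonzero. -/
theorem partitionExpo_empty_ne_zero (W : Finset (Fin h)) (hW : W ≠ ∅) :
    (∑ a' ∈ (∅ : Finset (Fin h)), Finsupp.single (Fin.castAdd h a') 1 +
        ∑ c ∈ W, Finsupp.single (Fin.natAdd h c) 1 : Fin (h + h) →₀ ℕ) ≠ 0 := by
  intro h0
  obtain ⟨c, hc⟩ := Finset.nonempty_iff_ne_empty.mpr hW
  have h1 := congrArg (fun v : Fin (h + h) →₀ ℕ => v (Fin.natAdd h c)) h0
  simp only [Finsupp.coe_zero, Pi.zero_apply, ProductStateSums.partitionExpo_apply_natAdd] at h1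
  rw [if_pos hc] at h1
  exact one_ne_zero h1

/-! ## 2. The reduced vertex polynomial `rr v` -/

/-- `rr v = ρ̂₁ v − (1 + inc v ∅)`: the row `{v}` of the normal form minus its constant term. -/
def rr (w : Fin r → Finset (Fin h)) (α β : {j : Fin r // (w j).card = 3} → Fin h) (v : Fin h) :
    MvPolynomial (Fin (h + h)) ℂ :=
  rho1 (desA w α β) (desB w) Finset.univ v - C (1 + (inc w α β v ∅ : ℂ))

/-- `rr v` is `y`-only. -/
theorem yOnly_rr (w : Fin r → Finset (Fin h)) (α β : {j : Fin r // (w j).card = 3} → Fin h) (v : Fin h) :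
    ∀ s ∈ (rr w α β v).support, ∀ a : Fin h, s (Fin.castAdd h a) = 0 :=
  yOnly_sub (yOnly_rho1 _ _ _ v) (yOnly_C _)

/-- **Coefficient table of `rr v`** (`|W| ≤ 3`):
`coeff (E ∅ W) (rr v) = if W = ∅ then 0 else (−1)^{|W|} |W|! ([W = {v}] + inc v W)`. -/
theorem coeff_rr (w : Fin r → Finset (Fin h)) (α β : {j : Fin r // (w j).card = 3} → Fin h) (v : Fin h)
    (W : Finset (Fin h)) (hW : W.card ≤ 3) :
    coeff (∑ a' ∈ (∅ : Finset (Fin h)), Finsupp.single (Fin.castAdd h a') 1 +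
        ∑ c ∈ W, Finsupp.single (Fin.natAdd h c) 1) (rr w α β v) =
      if W = ∅ then 0 else (-1) ^ W.card * (W.card.factorial : ℂ) * ((if W = {v} then 1 else 0) + (inc w α β v W : ℂ)) := by
  classical
  unfold rr
  rw [coeff_sub, coeff_rho1_des w α β v W hW, coeff_C]
  by_cases hW0 : W = ∅
  · subst hW0
    simp
  · have hC : (if (0 : Fin (h + h) →₀ ℕ) = ∑ a' ∈ (∅ : Finset (Fin h)), Finsupp.single (Fin.castAdd h a') 1 +
        ∑ c ∈ W, Finsupp.single (Fin.natAdd h c) 1 then (1 + (inc w α β v ∅ : ℂ)) else 0) = 0 :=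
      if_neg fun h0 => partitionExpo_empty_ne_zero W hW0 h0.symm
    rw [hC, sub_zero, if_neg hW0]
    congr 2
    by_cases hWv : W = {v}
    · rw [if_pos hWv, if_pos (hWv ▸ Finset.Subset.refl _)]
    · rw [if_neg hWv, if_neg]
      intro hsub
      rcases Finset.subset_singleton_iff.mp hsub with h0 | h1
      · exact hW0 h0
      · exact hWv h1

/-- The constant term of `rr v` vanishes. -/
theorem coeff_rr_empty (w : Fin r → Finset (Fin h)) (α β : {j : Fin r // (w j).card = 3} → Fin h) (v : Fin h) :
    coeff (∑ a' ∈ (∅ : Finset (Fin h)), Finsupp.single (Fin.castAdd h a') 1 +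
        ∑ c ∈ (∅ : Finset (Fin h)), Finsupp.single (Fin.natAdd h c) 1) (rr w α β v) = 0 := by
  rw [coeff_rr w α β v ∅ (by simp), if_pos rfl]

/-- Singleton coefficients of `rr v`: `−([c = v] + inc v {c})`. -/
theorem coeff_rr_single (w : Fin r → Finset (Fin h)) (α β : {j : Fin r // (w j).card = 3} → Fin h) (v c : Fin h) :
    coeff (∑ a' ∈ (∅ : Finset (Fin h)), Finsupp.single (Fin.castAdd h a') 1 +
        ∑ c' ∈ ({c} : Finset (Fin h)), Finsupp.single (Fin.natAdd h c') 1) (rr w α β v) =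
      -((if c = v then 1 else 0) + (inc w α β v {c} : ℂ)) := by
  rw [coeff_rr w α β v {c} (by simp), if_neg (Finset.singleton_ne_empty c), Finset.card_singleton]
  simp only [pow_one, Nat.factorial_one, Nat.cast_one, mul_one, Finset.singleton_inj]
  ring

/-- Pair coefficients of `rr v`: `2 · inc v W`. -/
theorem coeff_rr_two (w : Fin r → Finset (Fin h)) (α β : {j : Fin r // (w j).card = 3} → Fin h) (v : Fin h)
    (W : Finset (Fin h)) (hW : W.card = 2) :
    coeff (∑ a' ∈ (∅ : Finset (Fin h)), Finsupp.single (Fin.castAdd h a') 1 +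
        ∑ c ∈ W, Finsupp.single (Fin.natAdd h c) 1) (rr w α β v) = 2 * (inc w α β v W : ℂ) := by
  rw [coeff_rr w α β v W (by omega), if_neg (by rintro rfl; simp at hW), if_neg, hW]
  · simp only [Nat.factorial_two, Nat.cast_ofNat]; ring
  · rintro rfl; rw [Finset.card_singleton] at hW; omega

/-- Triple coefficients of `rr v`: `−6 · inc v W`. -/
theorem coeff_rr_three (w : Fin r → Finset (Fin h)) (α β : {j : Fin r // (w j).card = 3} → Fin h) (v : Fin h)
    (W : Finset (Fin h)) (hW : W.card = 3) :
    coeff (∑ a' ∈ (∅ : Finset (Fin h)), Finsupp.single (Fin.castAdd h a') 1 +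
        ∑ c ∈ W, Finsupp.single (Fin.natAdd h c) 1) (rr w α β v) = -6 * (inc w α β v W : ℂ) := by
  rw [coeff_rr w α β v W (by omega), if_neg (by rintro rfl; simp at hW), if_neg, hW]
  · norm_num [Nat.factorial]
  · rintro rfl; rw [Finset.card_singleton] at hW; omega

/-! ## 3. The pair-form defect `qq j = t_{inr j} − 1` -/

/-- `qq j = t_{inr j} − 1` (constant-free, `y`-only). -/
def qq (w : Fin r → Finset (Fin h)) (j : {j : Fin r // (w j).card = 3}) : MvPolynomial (Fin (h + h)) ℂ :=
  tinv (desB w) (Sum.inr j) - 1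

/-- `qq j` is `y`-only. -/
theorem yOnly_qq (w : Fin r → Finset (Fin h)) (j : {j : Fin r // (w j).card = 3}) :
    ∀ s ∈ (qq w j).support, ∀ a : Fin h, s (Fin.castAdd h a) = 0 := by
  unfold qq
  rw [← C_1]
  exact yOnly_sub (yOnly_tinv _ _) (yOnly_C 1)

/-- **Coefficient table of `qq j`** (`|W| ≤ 3`): `if W = ∅ then 0 else (−1)^{|W|} |W|! [W ⊆ w j]`. -/
theorem coeff_qq (w : Fin r → Finset (Fin h)) (j : {j : Fin r // (w j).card = 3}) (W : Finset (Fin h))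
    (hW : W.card ≤ 3) :
    coeff (∑ a' ∈ (∅ : Finset (Fin h)), Finsupp.single (Fin.castAdd h a') 1 +
        ∑ c ∈ W, Finsupp.single (Fin.natAdd h c) 1) (qq w j) =
      if W = ∅ then 0 else (-1) ^ W.card * (W.card.factorial : ℂ) * (if W ⊆ w j.1 then 1 else 0) := by
  classical
  unfold qq
  rw [coeff_sub, coeff_tinv_inr w j W hW, coeff_one]
  by_cases hW0 : W = ∅
  · subst hW0
    simp
  · have hC : (if (0 : Fin (h + h) →₀ ℕ) = ∑ a' ∈ (∅ : Finset (Fin h)), Finsupp.single (Fin.castAdd h a') 1 +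
        ∑ c ∈ W, Finsupp.single (Fin.natAdd h c) 1 then (1 : ℂ) else 0) = 0 :=
      if_neg fun h0 => partitionExpo_empty_ne_zero W hW0 h0.symm
    rw [hC, sub_zero, if_neg hW0]

/-- The constant term of `qq j` vanishes. -/
theorem coeff_qq_empty (w : Fin r → Finset (Fin h)) (j : {j : Fin r // (w j).card = 3}) :
    coeff (∑ a' ∈ (∅ : Finset (Fin h)), Finsupp.single (Fin.castAdd h a') 1 +
        ∑ c ∈ (∅ : Finset (Fin h)), Finsupp.single (Fin.natAdd h c) 1) (qq w j) = 0 := by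
  rw [coeff_qq w j ∅ (by simp), if_pos rfl]

/-- Singleton coefficients of `qq j`: `−[c ∈ w j]`. -/
theorem coeff_qq_single (w : Fin r → Finset (Fin h)) (j : {j : Fin r // (w j).card = 3}) (c : Fin h) :
    coeff (∑ a' ∈ (∅ : Finset (Fin h)), Finsupp.single (Fin.castAdd h a') 1 +
        ∑ c' ∈ ({c} : Finset (Fin h)), Finsupp.single (Fin.natAdd h c') 1) (qq w j) =
      -(if c ∈ w j.1 then 1 else 0 : ℂ) := by
  rw [coeff_qq w j {c} (by simp), if_neg (Finset.singleton_ne_empty c), Finset.card_singleton]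
  by_cases hc : c ∈ w j.1
  · rw [if_pos (Finset.singleton_subset_iff.mpr hc), if_pos hc]; norm_num
  · rw [if_neg (fun hs => hc (Finset.singleton_subset_iff.mp hs)), if_neg hc]; norm_num

/-- Pair coefficients of `qq j`: `2 · [W ⊆ w j]`. -/
theorem coeff_qq_two (w : Fin r → Finset (Fin h)) (j : {j : Fin r // (w j).card = 3}) (W : Finset (Fin h))
    (hW : W.card = 2) :
    coeff (∑ a' ∈ (∅ : Finset (Fin h)), Finsupp.single (Fin.castAdd h a') 1 +
        ∑ c ∈ W, Finsupp.single (Fin.natAdd h c) 1) (qq w j) = 2 * (if W ⊆ w j.1 then 1 else 0 : ℂ) := by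
  rw [coeff_qq w j W (by omega), if_neg (by rintro rfl; simp at hW), hW]
  simp only [Nat.factorial_two, Nat.cast_ofNat]; ring

/-- Triple coefficients of `qq j`: `−6 · [W ⊆ w j]`. -/
theorem coeff_qq_three (w : Fin r → Finset (Fin h)) (j : {j : Fin r // (w j).card = 3}) (W : Finset (Fin h))
    (hW : W.card = 3) :
    coeff (∑ a' ∈ (∅ : Finset (Fin h)), Finsupp.single (Fin.castAdd h a') 1 +
        ∑ c ∈ W, Finsupp.single (Fin.natAdd h c) 1) (qq w j) = -6 * (if W ⊆ w j.1 then 1 else 0 : ℂ) := by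
  rw [coeff_qq w j W (by omega), if_neg (by rintro rfl; simp at hW), hW]
  norm_num [Nat.factorial]

end

end Summit.ValiantsHypothesis.ValiantsHypothesis.Theorems.BarrierLever.ChowStarvedDesign
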